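import Summits.Ventures.Crystal3D.Theorems.StickyWulffConstantGenericWallFloorFramePropagationHcp
import Summits.Ventures.Crystal3D.StickySpheres.TriangleFrame
import Literature.MathematicalPhysics.StatisticalMechanics.BarlowTexturedSet
import HarnessLib

/-!
# Two fcc lattices sharing an adjacent slot pair (a unit triangle) are co-axial
# (crux `GenericWallFloor`, line `WallLedgerG`)

HONEST FRAMING. Part of the venture `Summits/Ventures/Crystal3D` (cell `crystal3d-full`), helper
`--supports` the crux `GenericWallFloor` (stmt-Ventures-19480) of `route-Ventures-StickyWulffConstant`,
registered line `WallLedgerG` (planner cf-p1 gen 16), stub `stub_twoSlabAdhesion : TwoSlabAdhesion`.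

The registry endgame of the slot ledger (seat 19480-p1's rigid-bicrystal rung: a `(111)`-face ball of
grain 1 saturated by three grain-2 balls is saturated in exact fcc or twin registry,
`rung_saturationRegistry111`; the three balls form a unit triangle that is a translate of a grain-1 layer
triangle) needs: **if the linear lattices `A₁·Λ₀` and `A₂·Λ₀` share two unit vectors `a, b` with
`⟪a, b⟫ = ½`, the pair is CO-AXIAL** (`coaxial_of_shared_adjacent_slots`; affine form
`coaxial_of_shared_triangle`).  Proof: an orthonormal frame `(a, (2/√3)(b − a/2), n)` gives an isometry
`L` with `L u₀ = a`, `L v₀ = b` (`exists_frame_isometry`); an fcc lattice `M·Λ₀` containing `u₀, v₀`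
contains the standard hexagon, so its unit shell, doubled, is a twelve-point configuration through
Hales's hexagon and hence a layer shell (`IsTwelveConfig.eq_layerShell`, Literature), centrally
symmetric hence of fcc type `layerShell σ (−σ)`, i.e. the shell of `B(σ)`; generator capture
(`image_const_eq_of_generators`) gives `M·Λ₀ = B(σ)` (`image_eq_barlow_const_of_mem_generators`); so
`Aᵢ·Λ₀ ∈ {L·Λ₀, L·Λ₀⁻}` for both grains and `coaxial_of_common_frame` concludes.

WHAT THIS IS NOT: nothing about packings or the areal part of the stub; rung F-C1 not moved.
-/

noncomputable section

namespace Summit.Ventures.Crystal3D.Theorems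

open Literature.MathematicalPhysics.StatisticalMechanics
open Literature.Geometry.DiscreteGeometry (layerSpacing hexagonSet holeTriple layerShell IsTwelveConfig
  mem_layerShell_iff apply_two_of_mem_hexagonSet apply_two_of_mem_holeTriple neg_mem_holeTriple_iff
  mem_holeTriple_one_iff mem_holeTriple_iff kissingShell_barlowStacking_eq_layerShell mem_kissingShell_iff)
open Literature.Barriers.AtomisticToContinuum (barlowAddSubgroupOfConst)
open scoped InnerProductSpace

/-! ### Scale `2` (Hales's normalisation) versus scale `1` (`barlowPos_two_layerSpacing`, Literature) -/

/-- **Half a layer-shell vector of fcc type `(σ, −σ)` is a site of `B(σ)`** (`σ = c = ±1`):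
`layerShell c (−c)` is the contact shell of the origin in `barlowStacking 2 layerSpacing (c)`. -/
theorem half_mem_barlow_of_mem_layerShell {c : ℤ} (hc : c = 1 ∨ c = -1) {x : EuclideanSpace ℝ (Fin 3)}
    (hx : x ∈ layerShell (c : ℝ) (-(c : ℝ))) :
    (1 / 2 : ℝ) • x ∈ barlowStacking 1 (Real.sqrt (2 / 3)) (fun _ : ℤ => c) := by
  have hH : IsHaggSeq (fun _ : ℤ => c) := fun _ => hc
  have hshell := kissingShell_barlowStacking_eq_layerShell hH 0 0 0
  rw [← hshell, mem_kissingShell_iff, barlowPos_two_layerSpacing, barlowPos_zero, smul_zero, zero_add] at hx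
  obtain ⟨⟨k, i, j, e⟩, -⟩ := hx
  rw [e, barlowPos_two_layerSpacing, smul_smul]
  norm_num
  exact ⟨k, i, j, rfl⟩

/-- The doubled in-layer generators are Hales's frame vectors. -/
theorem two_smul_generators :
    (2 : ℝ) • barlowPos 1 (Real.sqrt (2 / 3)) constHagg 0 1 0 = triangularVec₁ 2 ∧
    (2 : ℝ) • barlowPos 1 (Real.sqrt (2 / 3)) constHagg 0 0 1 = triangularVec₂ 2 := by
  constructor
  · simp only [barlowPos, triangularVec₁, triangularVec₂, barlowOffset, layerNormal, haggLabel_zero]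
    ext l; fin_cases l <;> simp
  · simp only [barlowPos, triangularVec₁, triangularVec₂, barlowOffset, layerNormal, haggLabel_zero]
    ext l; fin_cases l
    · simp
    · simp only [Fin.mk_one, Fin.isValue, PiLp.smul_apply, smul_eq_mul]; simp; ring
    · simp

/-! ### An fcc lattice through the standard adjacent pair `u₀, v₀` is `Λ₀` or `Λ₀⁻` -/

/-- **Rigid fcc lattices containing `u₀ = (1,0,0)` and `v₀ = (½,√3/2,0)` are `B(±1)`.**  If the image
`M·Λ₀` of the fcc lattice under a linear isometry contains the two standard in-layer generators, then
`M·Λ₀ = B(c)` for `c = 1` (`Λ₀` itself) or `c = −1` (the mirror twin `Λ₀⁻`). -/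
theorem image_eq_barlow_const_of_mem_generators
    (M : EuclideanSpace ℝ (Fin 3) ≃ₗᵢ[ℝ] EuclideanSpace ℝ (Fin 3))
    (hu : barlowPos 1 (Real.sqrt (2 / 3)) constHagg 0 1 0 ∈ M '' fccStacking 1 (Real.sqrt (2 / 3)))
    (hv : barlowPos 1 (Real.sqrt (2 / 3)) constHagg 0 0 1 ∈ M '' fccStacking 1 (Real.sqrt (2 / 3))) :
    ∃ c : ℤ, (c = 1 ∨ c = -1) ∧
      M '' fccStacking 1 (Real.sqrt (2 / 3)) = barlowStacking 1 (Real.sqrt (2 / 3)) (fun _ : ℤ => c) := by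
  classical
  set G₁ : AddSubgroup (EuclideanSpace ℝ (Fin 3)) :=
    barlowAddSubgroupOfConst 1 (Real.sqrt (2 / 3)) constHagg (fun _ => rfl) with hG₁
  have hG₁mem : ∀ w, w ∈ G₁ ↔ w ∈ fccStacking 1 (Real.sqrt (2 / 3)) := fun w => Iff.rfl
  set Λ' : Set (EuclideanSpace ℝ (Fin 3)) := M '' fccStacking 1 (Real.sqrt (2 / 3)) with hΛ'
  have hsub : ∀ x ∈ Λ', ∀ y ∈ Λ', x - y ∈ Λ' := by
    rintro _ ⟨p, hp, rfl⟩ _ ⟨q, hq, rfl⟩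
    exact ⟨p - q, (hG₁mem _).1 (G₁.sub_mem ((hG₁mem _).2 hp) ((hG₁mem _).2 hq)), by simp⟩
  have hneg : ∀ x ∈ Λ', -x ∈ Λ' := by
    rintro _ ⟨p, hp, rfl⟩
    exact ⟨-p, (hG₁mem _).1 (G₁.neg_mem ((hG₁mem _).2 hp)), by simp⟩
  have h0Λ : (0 : EuclideanSpace ℝ (Fin 3)) ∈ fccStacking 1 (Real.sqrt (2 / 3)) :=
    ⟨0, 0, 0, (barlowPos_zero _ _).symm⟩
  have hnorm : ∀ x ∈ Λ', x ≠ 0 → 1 ≤ ‖x‖ := by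
    rintro _ ⟨p, hp, rfl⟩ hne
    have hp0 : p ≠ 0 := fun h => hne (by rw [h, map_zero])
    rw [LinearIsometryEquiv.norm_map, ← dist_zero_left]
    exact le_dist_of_mem_barlowStacking_ideal isHaggSeq_const one_pos sqrt_twoThirds_sq h0Λ hp hp0.symm
  -- the unit shell of `Λ'` and its double
  set S₀ : Set (EuclideanSpace ℝ (Fin 3)) :=
    {w | w ∈ fccStacking 1 (Real.sqrt (2 / 3)) ∧ ‖w‖ = 1} with hS₀
  set S' : Set (EuclideanSpace ℝ (Fin 3)) := {x | x ∈ Λ' ∧ ‖x‖ = 1} with hS'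
  set S₂ : Set (EuclideanSpace ℝ (Fin 3)) := (fun x => (2 : ℝ) • x) '' S' with hS₂
  have hS'eq : S' = M '' S₀ := by
    ext x
    constructor
    · rintro ⟨⟨p, hp, rfl⟩, hx1⟩
      exact ⟨p, ⟨hp, by rwa [LinearIsometryEquiv.norm_map] at hx1⟩, rfl⟩
    · rintro ⟨p, ⟨hp, hp1⟩, rfl⟩
      exact ⟨⟨p, hp, rfl⟩, by rw [LinearIsometryEquiv.norm_map, hp1]⟩
  have hS₀card : S₀.ncard = 12 := by
    have h12 := ncard_touching_eq_twelve isHaggSeq_const one_pos sqrt_twoThirds_sq h0Λ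
    have hset : S₀ = {w | w ∈ barlowStacking 1 (Real.sqrt (2 / 3)) constHagg ∧
        dist (0 : EuclideanSpace ℝ (Fin 3)) w = 1} := by
      ext w
      simp only [hS₀, Set.mem_setOf_eq, dist_comm (0 : EuclideanSpace ℝ (Fin 3)), dist_zero_right]
      rfl
    rw [hset]; exact h12
  have h2inj : Function.Injective (fun x : EuclideanSpace ℝ (Fin 3) => (2 : ℝ) • x) :=
    smul_right_injective _ (two_ne_zero)
  have hS₂card : S₂.ncard = 12 := by
    rw [hS₂, Set.ncard_image_of_injective _ h2inj, hS'eq, Set.ncard_image_of_injective _ M.injective,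
      hS₀card]
  have hconf : IsTwelveConfig S₂ := by
    refine ⟨hS₂card, ?_, ?_⟩
    · rintro _ ⟨y, ⟨-, hy1⟩, rfl⟩
      rw [norm_smul, hy1, Real.norm_eq_abs, abs_of_pos two_pos, mul_one]
    · rintro _ ⟨y, ⟨hy, -⟩, rfl⟩ _ ⟨y', ⟨hy', -⟩, rfl⟩ hne
      have hyy : y - y' ≠ 0 := fun h => hne (by rw [sub_eq_zero.1 h])
      have := hnorm _ (hsub y hy y' hy') hyy
      rw [dist_eq_norm, ← smul_sub, norm_smul, Real.norm_eq_abs, abs_of_pos two_pos]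
      linarith
  -- the hexagon lies in `S₂`
  obtain ⟨nu, nv, nf⟩ := norm_barlowPos_generators isHaggSeq_const
  obtain ⟨gu, gv⟩ := two_smul_generators
  have huv1 : ‖barlowPos 1 (Real.sqrt (2 / 3)) constHagg 0 1 0 -
      barlowPos 1 (Real.sqrt (2 / 3)) constHagg 0 0 1‖ = 1 := by
    have h := norm_sub_sq_real (barlowPos 1 (Real.sqrt (2 / 3)) constHagg 0 1 0)
      (barlowPos 1 (Real.sqrt (2 / 3)) constHagg 0 0 1)
    rw [nu, nv, inner_inLayer] at h
    push_cast at h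
    have h1 : ‖barlowPos 1 (Real.sqrt (2 / 3)) constHagg 0 1 0 -
        barlowPos 1 (Real.sqrt (2 / 3)) constHagg 0 0 1‖ ^ 2 = 1 := by rw [h]; ring
    have h0 := norm_nonneg (barlowPos 1 (Real.sqrt (2 / 3)) constHagg 0 1 0 -
      barlowPos 1 (Real.sqrt (2 / 3)) constHagg 0 0 1)
    nlinarith
  have mem2 : ∀ y ∈ Λ', ‖y‖ = 1 → (2 : ℝ) • y ∈ S₂ := fun y hy hy1 => ⟨y, ⟨hy, hy1⟩, rfl⟩
  have hhex : hexagonSet ⊆ S₂ := by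
    intro x hx
    simp only [hexagonSet, Set.mem_insert_iff, Set.mem_singleton_iff] at hx
    rcases hx with rfl | rfl | rfl | rfl | rfl | rfl
    · rw [← gu]; exact mem2 _ hu nu
    · rw [← gu, ← smul_neg]; exact mem2 _ (hneg _ hu) (by rw [norm_neg, nu])
    · rw [← gv]; exact mem2 _ hv nv
    · rw [← gv, ← smul_neg]; exact mem2 _ (hneg _ hv) (by rw [norm_neg, nv])
    · rw [← gu, ← gv, ← smul_sub]; exact mem2 _ (hsub _ hu _ hv) huv1
    · rw [← gu, ← gv, ← smul_sub]
      exact mem2 _ (hsub _ hv _ hu) (by rw [← norm_neg, neg_sub, huv1])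
  obtain ⟨σ, σ', hσ, hσ', hS₂eq⟩ := hconf.eq_layerShell hhex
  -- central symmetry forces the fcc type `σ' = −σ`
  have hsymm : ∀ x ∈ S₂, -x ∈ S₂ := by
    rintro _ ⟨y, ⟨hy, hy1⟩, rfl⟩
    rw [← smul_neg]; exact mem2 _ (hneg _ hy) (by rw [norm_neg, hy1])
  have hσ'σ : σ' = -σ := by
    have hxp : σ • barlowOffset 2 + layerNormal layerSpacing ∈ layerShell σ σ' :=
      (mem_layerShell_iff).2 (Or.inr (Or.inl (by
        rw [add_sub_cancel_right, mem_holeTriple_iff]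
        exact ⟨_, mem_holeTriple_one_iff.2 (Or.inl rfl), rfl⟩)))
    rw [← hS₂eq] at hxp
    have hxm := hsymm _ hxp
    rw [hS₂eq, mem_layerShell_iff] at hxm
    have hpos : 0 < layerSpacing := Literature.Geometry.DiscreteGeometry.layerSpacing_pos
    rcases hxm with h | h | h
    · have := apply_two_of_mem_hexagonSet h
      simp at this
      linarith
    · have := apply_two_of_mem_holeTriple h
      simp at this
      linarith
    · rw [neg_add, neg_add_cancel_right, neg_mem_holeTriple_iff, mem_holeTriple_iff] at h
      obtain ⟨t, ht, e⟩ := h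
      rw [mem_holeTriple_one_iff] at ht
      have e0 := congrArg (fun q : EuclideanSpace ℝ (Fin 3) => q 0) e
      have e1 := congrArg (fun q : EuclideanSpace ℝ (Fin 3) => q 1) e
      have h3 : (0 : ℝ) < Real.sqrt 3 := Real.sqrt_pos.2 (by norm_num)
      rcases ht with rfl | rfl | rfl
      · simp at e0; linarith
      · simp at e0 e1
        rcases hσ with rfl | rfl <;> rcases hσ' with rfl | rfl <;> nlinarith
      · simp at e0
        rcases hσ with rfl | rfl <;> norm_num at e0
  subst hσ'σ
  -- an integer name for the sign
  obtain ⟨c, hc, hcσ⟩ : ∃ c : ℤ, (c = 1 ∨ c = -1) ∧ (c : ℝ) = σ := by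
    rcases hσ with rfl | rfl
    exacts [⟨1, Or.inl rfl, by simp⟩, ⟨-1, Or.inr rfl, by simp⟩]
  rw [← hcσ] at hS₂eq
  -- the three generators of `Λ₀` land in `B(c)`
  have land : ∀ g ∈ fccStacking 1 (Real.sqrt (2 / 3)), ‖g‖ = 1 →
      M g ∈ barlowStacking 1 (Real.sqrt (2 / 3)) (fun _ : ℤ => c) := by
    intro g hg hg1
    have h2 : (2 : ℝ) • M g ∈ layerShell (c : ℝ) (-(c : ℝ)) := by
      rw [← hS₂eq]; exact mem2 _ ⟨g, hg, rfl⟩ (by rw [LinearIsometryEquiv.norm_map, hg1])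
    have := half_mem_barlow_of_mem_layerShell hc h2
    rwa [smul_smul, show (1 / 2 : ℝ) * 2 = 1 by norm_num, one_smul] at this
  refine ⟨c, hc, ?_⟩
  exact image_const_eq_of_generators (Or.inl rfl) hc M (land _ ⟨0, 1, 0, rfl⟩ nu)
    (land _ ⟨0, 0, 1, rfl⟩ nv) (land _ ⟨1, 0, 0, rfl⟩ nf)

/-! ### A frame through a given adjacent pair -/

/-- The standard in-layer generators in coordinates: `u₀ = e₀`, `v₀ = ½ e₀ + (√3/2) e₁`. -/
theorem generators_eq_single :
    barlowPos 1 (Real.sqrt (2 / 3)) constHagg 0 1 0 = EuclideanSpace.single (0 : Fin 3) (1 : ℝ) ∧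
    barlowPos 1 (Real.sqrt (2 / 3)) constHagg 0 0 1 =
      (1 / 2 : ℝ) • EuclideanSpace.single (0 : Fin 3) (1 : ℝ) +
        (Real.sqrt 3 / 2) • EuclideanSpace.single (1 : Fin 3) (1 : ℝ) := by
  constructor
  · ext l
    fin_cases l <;> simp
  · ext l
    fin_cases l <;> simp

/-- **A rigid frame through an adjacent pair.**  For unit vectors `a, b` with `⟪a, b⟫ = ½` there is a
linear isometry `L` of `ℝ³` with `L u₀ = a`, `L v₀ = b` (orthonormal frame `a`, `(2/√3)(b − a/2)`,
unit normal; `OrthonormalBasis.repr`). -/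
theorem exists_frame_isometry (a b : EuclideanSpace ℝ (Fin 3)) (ha : ‖a‖ = 1) (hb : ‖b‖ = 1)
    (hab : ⟪a, b⟫_ℝ = 1 / 2) :
    ∃ L : EuclideanSpace ℝ (Fin 3) ≃ₗᵢ[ℝ] EuclideanSpace ℝ (Fin 3),
      L (barlowPos 1 (Real.sqrt (2 / 3)) constHagg 0 1 0) = a ∧
        L (barlowPos 1 (Real.sqrt (2 / 3)) constHagg 0 0 1) = b := by
  obtain ⟨w, haw, hbw, hww⟩ := Summit.Ventures.Crystal3D.exists_frame_normal a b
  have h3 : Real.sqrt 3 * Real.sqrt 3 = 3 := Real.mul_self_sqrt (by norm_num)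
  have h3p : 0 < Real.sqrt 3 := Real.sqrt_pos.2 (by norm_num)
  have h23 : Real.sqrt (2 / 3) * Real.sqrt (2 / 3) = 2 / 3 := Real.mul_self_sqrt (by norm_num)
  have haa : ⟪a, a⟫_ℝ = 1 := by rw [real_inner_self_eq_norm_sq, ha, one_pow]
  have hbb : ⟪b, b⟫_ℝ = 1 := by rw [real_inner_self_eq_norm_sq, hb, one_pow]
  have hba : ⟪b, a⟫_ℝ = 1 / 2 := by rw [real_inner_comm]; exact hab
  have hwa : ⟪w, a⟫_ℝ = 0 := by rw [real_inner_comm]; exact haw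
  have hwb : ⟪w, b⟫_ℝ = 0 := by rw [real_inner_comm]; exact hbw
  set e₂ : EuclideanSpace ℝ (Fin 3) := (2 / Real.sqrt 3) • (b - (1 / 2 : ℝ) • a) with he₂
  set e₃ : EuclideanSpace ℝ (Fin 3) := Real.sqrt (2 / 3) • w with he₃
  set v : Fin 3 → EuclideanSpace ℝ (Fin 3) := ![a, e₂, e₃] with hv
  -- Gram table
  have g11 : ⟪a, e₂⟫_ℝ = 0 := by
    rw [he₂, real_inner_smul_right, inner_sub_right, real_inner_smul_right, hab, haa]; ring
  have g22 : ⟪e₂, e₂⟫_ℝ = 1 := by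
    rw [he₂, real_inner_smul_left, real_inner_smul_right, inner_sub_left, inner_sub_right,
      inner_sub_right, real_inner_smul_left, real_inner_smul_right, real_inner_smul_left,
      real_inner_smul_right, haa, hab, hba, hbb]
    field_simp
    nlinarith [h3]
  have g13 : ⟪a, e₃⟫_ℝ = 0 := by rw [he₃, real_inner_smul_right, haw, mul_zero]
  have g23 : ⟪e₂, e₃⟫_ℝ = 0 := by
    rw [he₂, he₃, real_inner_smul_left, real_inner_smul_right, inner_sub_left, real_inner_smul_left,
      hbw, haw]; ring
  have g33 : ⟪e₃, e₃⟫_ℝ = 1 := by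
    rw [he₃, real_inner_smul_left, real_inner_smul_right, hww, ← mul_assoc, h23]; norm_num
  have hon : Orthonormal ℝ v := by
    rw [orthonormal_iff_ite]
    intro i j
    fin_cases i <;> fin_cases j
    · simpa [hv] using haa
    · simpa [hv] using g11
    · simpa [hv] using g13
    · simpa [hv, real_inner_comm] using g11
    · simpa [hv] using g22
    · simpa [hv] using g23
    · simpa [hv, real_inner_comm] using g13
    · simpa [hv, real_inner_comm] using g23
    · simpa [hv] using g33
  have hsp : ⊤ ≤ Submodule.span ℝ (Set.range v) :=
    (hon.linearIndependent.span_eq_top_of_card_eq_finrank' (by simp)).ge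
  set B := OrthonormalBasis.mk hon hsp with hB
  obtain ⟨gu, gv⟩ := generators_eq_single
  refine ⟨B.repr.symm, ?_, ?_⟩
  · rw [gu, B.repr_symm_single, hB, OrthonormalBasis.coe_mk]
    simp [hv]
  · rw [gv, map_add, map_smul, map_smul, B.repr_symm_single, B.repr_symm_single, hB,
      OrthonormalBasis.coe_mk]
    simp only [hv, Matrix.cons_val_zero, Matrix.cons_val_one, he₂, smul_smul]
    rw [show Real.sqrt 3 / 2 * (2 / Real.sqrt 3) = 1 by field_simp, one_smul]
    abel

/-! ### The co-axiality theorems -/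

/-- **Two fcc lattices sharing an adjacent slot pair are co-axial.**  If the linear lattices
`A₁·Λ₀`, `A₂·Λ₀` both contain unit vectors `a, b` with `⟪a, b⟫ = ½` (a unit triangle `{0, a, b}`,
e.g. the edge vectors of a registry slot triple), then the moved lattices `A₁·Λ₀ + t₁`, `A₂·Λ₀ + t₂` are
co-axial for every `t₁, t₂` — the literal `∃`-clause of `GenericWallFloor` / `TwoSlabAdhesion`. -/
theorem coaxial_of_shared_adjacent_slots
    (A₁ A₂ : EuclideanSpace ℝ (Fin 3) ≃ₗᵢ[ℝ] EuclideanSpace ℝ (Fin 3)) (t₁ t₂ a b : EuclideanSpace ℝ (Fin 3))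
    (ha₁ : a ∈ A₁ '' fccStacking 1 (Real.sqrt (2 / 3))) (hb₁ : b ∈ A₁ '' fccStacking 1 (Real.sqrt (2 / 3)))
    (ha₂ : a ∈ A₂ '' fccStacking 1 (Real.sqrt (2 / 3))) (hb₂ : b ∈ A₂ '' fccStacking 1 (Real.sqrt (2 / 3)))
    (ha : ‖a‖ = 1) (hb : ‖b‖ = 1) (hab : ⟪a, b⟫_ℝ = 1 / 2) :
    ∃ (L' : EuclideanSpace ℝ (Fin 3) ≃ₗᵢ[ℝ] EuclideanSpace ℝ (Fin 3))
      (s₁ s₂ : EuclideanSpace ℝ (Fin 3)) (σ σ' : ℤ → ℤ), IsHaggSeq σ ∧ IsHaggSeq σ' ∧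
      (fun p => A₁ p + t₁) '' fccStacking 1 (Real.sqrt (2 / 3)) ⊆
        (fun p => L' p + s₁) '' barlowStacking 1 (Real.sqrt (2 / 3)) σ ∧
      (fun p => A₂ p + t₂) '' fccStacking 1 (Real.sqrt (2 / 3)) ⊆
        (fun p => L' p + s₂) '' barlowStacking 1 (Real.sqrt (2 / 3)) σ' := by
  obtain ⟨L, hLu, hLv⟩ := exists_frame_isometry a b ha hb hab
  have key : ∀ A : EuclideanSpace ℝ (Fin 3) ≃ₗᵢ[ℝ] EuclideanSpace ℝ (Fin 3),
      a ∈ A '' fccStacking 1 (Real.sqrt (2 / 3)) → b ∈ A '' fccStacking 1 (Real.sqrt (2 / 3)) →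
      (A '' fccStacking 1 (Real.sqrt (2 / 3)) = L '' fccStacking 1 (Real.sqrt (2 / 3)) ∨
        A '' fccStacking 1 (Real.sqrt (2 / 3)) =
          L '' barlowStacking 1 (Real.sqrt (2 / 3)) (fun _ : ℤ => (-1 : ℤ))) := by
    intro A haA hbA
    set M : EuclideanSpace ℝ (Fin 3) ≃ₗᵢ[ℝ] EuclideanSpace ℝ (Fin 3) := A.trans L.symm with hM
    have hMw : ∀ x, M x = L.symm (A x) := fun x => rfl
    have pull : ∀ {x y : EuclideanSpace ℝ (Fin 3)}, x ∈ A '' fccStacking 1 (Real.sqrt (2 / 3)) →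
        L y = x → y ∈ M '' fccStacking 1 (Real.sqrt (2 / 3)) := by
      rintro x y ⟨p, hp, rfl⟩ hy
      exact ⟨p, hp, by rw [hMw, ← hy, LinearIsometryEquiv.symm_apply_apply]⟩
    obtain ⟨c, hc, hMc⟩ := image_eq_barlow_const_of_mem_generators M (pull haA hLu) (pull hbA hLv)
    have hLM : A '' fccStacking 1 (Real.sqrt (2 / 3)) = L '' (M '' fccStacking 1 (Real.sqrt (2 / 3))) := by
      rw [Set.image_image]
      exact Set.image_congr fun x _ => by rw [hMw, LinearIsometryEquiv.apply_symm_apply]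
    rw [hLM, hMc]
    rcases hc with rfl | rfl
    · exact Or.inl rfl
    · exact Or.inr rfl
  exact coaxial_of_common_frame A₁ A₂ L t₁ t₂ (key A₁ ha₁ hb₁) (key A₂ ha₂ hb₂)

/-- Differences of points of a moved lattice `A·Λ₀ + t` lie in the linear lattice `A·Λ₀`. -/
theorem sub_mem_image_of_mem_affine (A : EuclideanSpace ℝ (Fin 3) ≃ₗᵢ[ℝ] EuclideanSpace ℝ (Fin 3))
    (t x y : EuclideanSpace ℝ (Fin 3))
    (hx : x ∈ (fun p => A p + t) '' fccStacking 1 (Real.sqrt (2 / 3)))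
    (hy : y ∈ (fun p => A p + t) '' fccStacking 1 (Real.sqrt (2 / 3))) :
    x - y ∈ A '' fccStacking 1 (Real.sqrt (2 / 3)) := by
  obtain ⟨p, hp, rfl⟩ := hx
  obtain ⟨q, hq, rfl⟩ := hy
  set G₁ : AddSubgroup (EuclideanSpace ℝ (Fin 3)) :=
    barlowAddSubgroupOfConst 1 (Real.sqrt (2 / 3)) constHagg (fun _ => rfl) with hG₁
  have hG₁mem : ∀ w, w ∈ G₁ ↔ w ∈ fccStacking 1 (Real.sqrt (2 / 3)) := fun w => Iff.rfl
  exact ⟨p - q, (hG₁mem _).1 (G₁.sub_mem ((hG₁mem _).2 hp) ((hG₁mem _).2 hq)), by simp⟩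

/-- **Two moved fcc lattices containing translates of one unit triangle are co-axial** (affine form:
`p₁, p₁ + a, p₁ + b ∈ A₁·Λ₀ + t₁` and `p₂, p₂ + a, p₂ + b ∈ A₂·Λ₀ + t₂` with `‖a‖ = ‖b‖ = 1`,
`⟪a, b⟫ = ½`).  This is the registry endgame of the slot ledger: a `(111)`-face ball of grain 1
saturated by three grain-2 balls in fcc or twin registry exhibits such a shared triangle. -/
theorem coaxial_of_shared_triangle
    (A₁ A₂ : EuclideanSpace ℝ (Fin 3) ≃ₗᵢ[ℝ] EuclideanSpace ℝ (Fin 3))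
    (t₁ t₂ p₁ p₂ a b : EuclideanSpace ℝ (Fin 3))
    (h₁ : p₁ ∈ (fun p => A₁ p + t₁) '' fccStacking 1 (Real.sqrt (2 / 3)))
    (h₁a : p₁ + a ∈ (fun p => A₁ p + t₁) '' fccStacking 1 (Real.sqrt (2 / 3)))
    (h₁b : p₁ + b ∈ (fun p => A₁ p + t₁) '' fccStacking 1 (Real.sqrt (2 / 3)))
    (h₂ : p₂ ∈ (fun p => A₂ p + t₂) '' fccStacking 1 (Real.sqrt (2 / 3)))
    (h₂a : p₂ + a ∈ (fun p => A₂ p + t₂) '' fccStacking 1 (Real.sqrt (2 / 3)))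
    (h₂b : p₂ + b ∈ (fun p => A₂ p + t₂) '' fccStacking 1 (Real.sqrt (2 / 3)))
    (ha : ‖a‖ = 1) (hb : ‖b‖ = 1) (hab : ⟪a, b⟫_ℝ = 1 / 2) :
    ∃ (L' : EuclideanSpace ℝ (Fin 3) ≃ₗᵢ[ℝ] EuclideanSpace ℝ (Fin 3))
      (s₁ s₂ : EuclideanSpace ℝ (Fin 3)) (σ σ' : ℤ → ℤ), IsHaggSeq σ ∧ IsHaggSeq σ' ∧
      (fun p => A₁ p + t₁) '' fccStacking 1 (Real.sqrt (2 / 3)) ⊆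
        (fun p => L' p + s₁) '' barlowStacking 1 (Real.sqrt (2 / 3)) σ ∧
      (fun p => A₂ p + t₂) '' fccStacking 1 (Real.sqrt (2 / 3)) ⊆
        (fun p => L' p + s₂) '' barlowStacking 1 (Real.sqrt (2 / 3)) σ' := by
  refine coaxial_of_shared_adjacent_slots A₁ A₂ t₁ t₂ a b ?_ ?_ ?_ ?_ ha hb hab
  · simpa using sub_mem_image_of_mem_affine A₁ t₁ _ _ h₁a h₁
  · simpa using sub_mem_image_of_mem_affine A₁ t₁ _ _ h₁b h₁
  · simpa using sub_mem_image_of_mem_affine A₂ t₂ _ _ h₂a h₂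
  · simpa using sub_mem_image_of_mem_affine A₂ t₂ _ _ h₂b h₂

end Summit.Ventures.Crystal3D.Theorems

end
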